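import Mathlib
import HarnessLib
import Summits.Langlands.Langlands.Theorems.SatakeFamilyReach
import Literature.NumberTheory.Automorphic.Sweep1SymmetricPower
import Literature.NumberTheory.Automorphic.PairLFunctionBaseChange

/-!
# Satake-family reach vocabulary, §2 (definitions only): FUNCTORIAL DOORS — `FDoor`, `FShadow`, `FReach`
# (lens-3 g6 node `FunctorialReachSplit`; extends `Theorems/SatakeFamilyReach.lean` §1 in the same namespace)

Definitions ONLY.  `FDoor L n c`: the Satake family `c` is a.e. a print-functorial image of cuspidal L-algebraic data
of rank ≤ 3 — `Symᵐ(π) ⊗ χ`, m = 2, 3, 4 (tree `Literature.NumberTheory.Automorphic.symmPowerParams`;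
[cite: GelbartJacquet1978, Thm. 9.3] [cite: KimShahidi2002, Thm. B] [cite: Kim2003, Thm. B]), `π ⊠ π'` for
`GL₂ × GL₂` (tree `satakeTensor`; [cite: Ramakrishnan2000, Thm. M]) and `GL₂ × GL₃` ([cite: KimShahidi2002, Thm. A]);
`FShadow K n a`: linked (in 𝒢(K, n), or in 𝒢(L, n) after one solvable Galois `Link`) to a door vertex;
`FReach := Reach ∨ FShadow`.
-/

set_option linter.dupNamespace false
set_option linter.unusedVariables false

namespace Summit.Langlands.Langlands.Theorems.SatakeFamilyReach

open scoped Valued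
open Filter

section FunctorialDoors

variable {K : Type} [Field K] [NumberField K]

/-- FUNCTORIAL DOOR (lens-3 g6, NEW): the rank-`n` Satake family `c` over `L` is, at almost every finite place, a
PRINT-FUNCTORIAL IMAGE of cuspidal `L`-algebraic Satake data of rank ≤ 3 — a twisted symmetric power
`Symᵐ(π) ⊗ χ` of `GL₂`-data (`m = 2, 3, 4`, `n = m + 1`: Gelbart–Jacquet 1978, Kim–Shahidi 2002, Kim 2003; tree
vocabulary `symmPowerParams`), or a Rankin–Selberg product `π ⊠ π'` of `GL₂ × GL₂`-data (`n = 4`: Ramakrishnan 2000,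
tree `satakeTensor`, `Ramakrishnan2000_theoremM`) or of `GL₂ × GL₃`-data (`n = 6`: Kim–Shahidi 2002 Thm A).
No door in ranks 1, 2 (`fDoor_two_false` in the g6 node). -/
def FDoor (L : Type) [Field L] [NumberField L] (n : ℕ)
    (c : IsDedekindDomain.HeightOneSpectrum (NumberField.RingOfIntegers L) → Multiset ℂ) : Prop :=
  (∃ m : ℕ, (m = 2 ∨ m = 3 ∨ m = 4) ∧ n = m + 1 ∧ ∃ (π : Literature.NumberTheory.Automorphic.CuspidalAutomorphicRepData 2 L (Literature.NumberTheory.Automorphic.isCompact_glFiniteIntegralLevel_holds 2 L)) (χ : Literature.NumberTheory.Automorphic.CuspidalAutomorphicRepData 1 L (Literature.NumberTheory.Automorphic.isCompact_glFiniteIntegralLevel_holds 1 L)), π.1.IsLAlgebraic ∧ χ.1.IsLAlgebraic ∧ ∀ᶠ w : IsDedekindDomain.HeightOneSpectrum (NumberField.RingOfIntegers L) in cofinite, ∃ a b t : ℂ, π.1.HasSatakeParamAt w {a, b} ∧ χ.1.HasSatakeParamAt w {t} ∧ c w = (Literature.NumberTheory.Automorphic.symmPowerParams m a b).map (t * ·))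 ∨ (n = 4 ∧ ∃ (π π' : Literature.NumberTheory.Automorphic.CuspidalAutomorphicRepData 2 L (Literature.NumberTheory.Automorphic.isCompact_glFiniteIntegralLevel_holds 2 L)), π.1.IsLAlgebraic ∧ π'.1.IsLAlgebraic ∧ ∀ᶠ w : IsDedekindDomain.HeightOneSpectrum (NumberField.RingOfIntegers L) in cofinite, ∃ α β : Multiset ℂ, π.1.HasSatakeParamAt w α ∧ π'.1.HasSatakeParamAt w β ∧ c w = Literature.NumberTheory.Automorphic.satakeTensor α β) ∨ (n = 6 ∧ ∃ (π : Literature.NumberTheory.Automorphic.CuspidalAutomorphicRepData 2 L (Literature.NumberTheory.Automorphic.isCompact_glFiniteIntegralLevel_holds 2 L)) (π' : Literature.NumberTheory.Automorphic.CuspidalAutomorphicRepData 3 L (Literature.NumberTheory.Automorphic.isCompact_glFiniteIntegralLevel_holds 3 L)), π.1.IsLAlgebraic ∧ π'.1.IsLAlgebraic ∧ ∀ᶠ w : IsDedekindDomain.HeightOneSpectrum (NumberField.RingOfIntegers L) in cofinite, ∃ α β : Multiset ℂ, π.1.HasSatakeParamAt w α ∧ π'.1.HasSatakeParamAt w β ∧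 c w = Literature.NumberTheory.Automorphic.satakeTensor α β)

/-- FUNCTORIAL SHADOW (lens-3 g6, NEW): `a` is LINKED in 𝒢(K, n) to a family passing a functorial door, or — after ONE
finite Galois SOLVABLE `L/K` along a `Link` (g5) — linked in 𝒢(L, n) to such a family. -/
def FShadow (K : Type) [Field K] [NumberField K] (n : ℕ)
    (a : IsDedekindDomain.HeightOneSpectrum (NumberField.RingOfIntegers K) → Multiset ℂ) : Prop :=
  (∃ c : IsDedekindDomain.HeightOneSpectrum (NumberField.RingOfIntegers K) → Multiset ℂ, Linked n a c ∧ FDoor K n c) ∨ ∃ (L : Type) (_ : Field L) (_ : NumberField L) (_ : Algebra K L), IsGalois K L ∧ IsSolvable (L ≃ₐ[K] L) ∧ ∃ b : IsDedekindDomain.HeightOneSpectrum (NumberField.RingOfIntegers L) → Multiset ℂ, Link K n a L b ∧ ∃ c : IsDedekindDomain.HeightOneSpectrum (NumberField.RingOfIntegers L) → Multiset ℂ, Linked n b c ∧ FDoor L n c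

/-- FUNCTORIAL REACH (lens-3 g6, NEW): solvable reach (g5 `Reach`) OR a functorial shadow. -/
def FReach (K : Type) [Field K] [NumberField K] (n : ℕ)
    (hcpt : Literature.NumberTheory.Automorphic.isCompact_glFiniteIntegralLevel n K)
    (a : IsDedekindDomain.HeightOneSpectrum (NumberField.RingOfIntegers K) → Multiset ℂ) : Prop :=
  Reach K n hcpt a ∨ FShadow K n a

end FunctorialDoors

end Summit.Langlands.Langlands.Theorems.SatakeFamilyReach
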